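import Mathlib
import Summits.NavierStokesRegularity.NavierStokesRegularity.Theorems.EulerZoomLiouvillePowerGaugeEulerLiouvilleModulatedEulerBrackets
import HarnessLib

/-!
# Crux `EulerZoomLiouville.PowerGaugeEulerLiouville` (stmt-NavierStokesRegularity-19832), stub `stub_nonSelfSimilarRest`:
# the RICCATI case of the pattern lane `v = U₀(x) + θ(τ) U₁(x)` — the brackets SPLIT (tools for the evanescent residual)

Helper file (theorems only; `--supports stmt-NavierStokesRegularity-19832`; def-free).  Hand leafhand-ns-eulerzoomliouville-11 g0;
sequel to `…ModulatedEulerBrackets` / `…ModulatedEulerPast`, which close the lane OFF the Riccati family.  ON the family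
(`θ' = α + βθ + γθ²` on `(−∞,T₁)`, `θ ∈ C¹` non-constant there) the pointwise momentum bracket `N₀₀ + θ N× + θ² N₁₁ = θ' A₁` becomes a
quadratic identity in the VALUES of `θ`; since a non-constant continuous `θ` takes three distinct values on the past (intermediate value
theorem), all three coefficients vanish (`ModulatedEuler.riccati_split`):
`N₀₀(Φ) = α A₁(Φ)`, `N×(Φ) = β A₁(Φ)`, `N₁₁(Φ) = γ A₁(Φ)` for every divergence-free test field `Φ`, and `U₀`, `U₁` are both weakly
divergence free (`ModulatedEuler.isWeaklyDivFree_pair_of_nonconstant`).  In the EVANESCENT normalisation (`θ → r` a root, i.e. `α = 0`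
after `U₀ ↦ U₀ + rU₁`, `θ ↦ θ − r`) this says: `U₀` IS A STEADY WEAK EULER FIELD (`∫⟪U₀, DΦ·U₀⟫ = 0` for all divergence-free test `Φ`,
`ModulatedEuler.steady_weak_euler_of_riccati_root`) — the input of the `E`-gauge two-pattern argument that is to close the lane
(census of this hand, item T-e).

WHAT THIS IS NOT: not a proof of the stub or of the crux; nothing about Navier–Stokes. [folklore]
-/

noncomputable section

-- flat `Theorems/<Route><Decl>…` files of one crux share the namespace of the crux (tree convention)
set_option linter.dupNamespace false

open MeasureTheory Set Filter Topology Metric Function TopologicalSpace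
open scoped RealInnerProductSpace NNReal ENNReal ContDiff

namespace Summit.NavierStokesRegularity.NavierStokesRegularity.Theorems.PowerGaugeEulerLiouville

open Literature.Analysis Literature.Analysis.FunctionSpaces Literature.Analysis.FluidPDE

namespace ModulatedEuler

variable {v : ℝ → EuclideanSpace ℝ (Fin 3) → EuclideanSpace ℝ (Fin 3)} {p : ℝ → EuclideanSpace ℝ (Fin 3) → ℝ}
  {θ : ℝ → ℝ} {U₀ U₁ : EuclideanSpace ℝ (Fin 3) → EuclideanSpace ℝ (Fin 3)} {T₁ : ℝ}

/-- A real quadratic `a + b v + c v²` vanishing at three distinct points is zero. [folklore] -/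
theorem quad_coeffs_eq_zero {a b c v₁ v₂ v₃ : ℝ} (h12 : v₁ ≠ v₂) (h13 : v₁ ≠ v₃) (h23 : v₂ ≠ v₃)
    (h₁ : a + b * v₁ + c * v₁ ^ 2 = 0) (h₂ : a + b * v₂ + c * v₂ ^ 2 = 0) (h₃ : a + b * v₃ + c * v₃ ^ 2 = 0) :
    a = 0 ∧ b = 0 ∧ c = 0 := by
  have d12 : (v₁ - v₂) * (b + c * (v₁ + v₂)) = 0 := by linear_combination h₁ - h₂
  have d13 : (v₁ - v₃) * (b + c * (v₁ + v₃)) = 0 := by linear_combination h₁ - h₃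
  have e12 : b + c * (v₁ + v₂) = 0 := (mul_eq_zero.1 d12).resolve_left (sub_ne_zero.2 h12)
  have e13 : b + c * (v₁ + v₃) = 0 := (mul_eq_zero.1 d13).resolve_left (sub_ne_zero.2 h13)
  have hc0 : c * (v₂ - v₃) = 0 := by linear_combination e12 - e13
  have hc : c = 0 := (mul_eq_zero.1 hc0).resolve_right (sub_ne_zero.2 h23)
  have hb : b = 0 := by rw [hc] at e12; linarith
  refine ⟨?_, hb, hc⟩
  rw [hb, hc] at h₁; linarith

/-- A continuous `θ` taking two distinct values at times `t, t' < T₁` takes three pairwise distinct values on `(−∞,T₁)`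
(intermediate value theorem). [folklore] -/
theorem exists_three_values (hθc : Continuous θ) {t t' : ℝ} (ht : t < T₁) (ht' : t' < T₁) (hne : θ t ≠ θ t') :
    ∃ s, s < T₁ ∧ θ s ≠ θ t ∧ θ s ≠ θ t' := by
  set m : ℝ := (θ t + θ t') / 2 with hm
  have hm_mem : m ∈ uIcc (θ t) (θ t') := by
    rcases le_total (θ t) (θ t') with h | h
    · rw [uIcc_of_le h]; exact ⟨by rw [hm]; linarith, by rw [hm]; linarith⟩
    · rw [uIcc_of_ge h]; exact ⟨by rw [hm]; linarith, by rw [hm]; linarith⟩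
  obtain ⟨s, hs, hθs⟩ := intermediate_value_uIcc hθc.continuousOn hm_mem
  refine ⟨s, ?_, ?_, ?_⟩
  · rcases le_total t t' with h | h
    · rw [uIcc_of_le h] at hs; exact lt_of_le_of_lt hs.2 ht'
    · rw [uIcc_of_ge h] at hs; exact lt_of_le_of_lt hs.2 ht
  · rw [hθs, hm]; intro h; apply hne; linarith
  · rw [hθs, hm]; intro h; apply hne; linarith

/-- **THE RICCATI SPLIT.**  For a distributional Euler pair with literal slices `v(τ) = U₀ + θ(τ) U₁` (`τ < T₁ ≤ 0`, `θ ∈ C¹`,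
`U₀, U₁ ∈ L¹_loc ∩ L²_loc`) whose modulation solves `θ' = α + βθ + γθ²` on `(−∞,T₁)` and is NOT constant there, and every
divergence-free test field `Φ`: `N₀₀(Φ) = α A₁(Φ)`, `N×(Φ) = β A₁(Φ)`, `N₁₁(Φ) = γ A₁(Φ)`. [folklore] -/
theorem riccati_split
    (hsol : IsDistributionalNSSolutionOn (slab (EuclideanSpace ℝ (Fin 3)) (Iio 0) isOpen_Iio) 0 0 v p)
    (hT₁ : T₁ ≤ 0) (hv : ∀ τ, τ < T₁ → v τ = fun x => U₀ x + θ τ • U₁ x) (hθ1 : ContDiff ℝ 1 θ)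
    {α β γ : ℝ} (hode : ∀ t, t < T₁ → deriv θ t = α + β * θ t + γ * θ t ^ 2)
    {t t' : ℝ} (ht : t < T₁) (ht' : t' < T₁) (hne : θ t ≠ θ t')
    (hU₀ : LocallyIntegrable U₀ volume) (hU₁ : LocallyIntegrable U₁ volume)
    (hU₀2 : LocallyIntegrable (fun y => ‖U₀ y‖ ^ 2) volume) (hU₁2 : LocallyIntegrable (fun y => ‖U₁ y‖ ^ 2) volume)
    {Φ : EuclideanSpace ℝ (Fin 3) → EuclideanSpace ℝ (Fin 3)} (hΦ : IsTestFunctionOn (⊤ : Opens (EuclideanSpace ℝ (Fin 3))) Φ)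
    (hdiv : ∀ z, VectorCalculus.divergence Φ z = 0) :
    (∫ y, ⟪U₀ y, (fderiv ℝ Φ y) (U₀ y)⟫) = α * ∫ y, ⟪U₁ y, Φ y⟫ ∧
    ((∫ y, ⟪U₀ y + U₁ y, (fderiv ℝ Φ y) (U₀ y + U₁ y)⟫) - (∫ y, ⟪U₀ y, (fderiv ℝ Φ y) (U₀ y)⟫) -
        ∫ y, ⟪U₁ y, (fderiv ℝ Φ y) (U₁ y)⟫) = β * ∫ y, ⟪U₁ y, Φ y⟫ ∧
    (∫ y, ⟪U₁ y, (fderiv ℝ Φ y) (U₁ y)⟫) = γ * ∫ y, ⟪U₁ y, Φ y⟫ := by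
  set A₁ : ℝ := ∫ y, ⟪U₁ y, Φ y⟫
  set N₀ : ℝ := ∫ y, ⟪U₀ y, (fderiv ℝ Φ y) (U₀ y)⟫
  set N₁ : ℝ := ∫ y, ⟪U₁ y, (fderiv ℝ Φ y) (U₁ y)⟫
  set NS : ℝ := ∫ y, ⟪U₀ y + U₁ y, (fderiv ℝ Φ y) (U₀ y + U₁ y)⟫
  obtain ⟨s, hs, hst, hst'⟩ := exists_three_values hθ1.continuous ht ht' hne
  -- the quadratic identity in the values of `θ`
  have hq : ∀ r, r < T₁ → (N₀ - α * A₁) + (NS - N₀ - N₁ - β * A₁) * θ r + (N₁ - γ * A₁) * θ r ^ 2 = 0 := by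
    intro r hr
    have h := pointwise_momentum hsol hT₁ hv hθ1 hU₀ hU₁ hU₀2 hU₁2 hΦ hdiv hr
    rw [hode r hr] at h
    linear_combination h
  obtain ⟨h0, h1, h2⟩ := quad_coeffs_eq_zero (v₁ := θ t) (v₂ := θ t') (v₃ := θ s) hne (Ne.symm hst) (Ne.symm hst')
    (hq t ht) (hq t' ht') (hq s hs)
  exact ⟨by linarith, by linarith, by linarith⟩

/-- **Both patterns are weakly divergence free** as soon as `θ` is not constant on the past (no ODE needed). [folklore] -/
theorem isWeaklyDivFree_pair_of_nonconstant
    (hsol : IsDistributionalNSSolutionOn (slab (EuclideanSpace ℝ (Fin 3)) (Iio 0) isOpen_Iio) 0 0 v p)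
    (hT₁ : T₁ ≤ 0) (hv : ∀ τ, τ < T₁ → v τ = fun x => U₀ x + θ τ • U₁ x) (hθc : Continuous θ)
    {t t' : ℝ} (ht : t < T₁) (ht' : t' < T₁) (hne : θ t ≠ θ t')
    (hU₀ : LocallyIntegrable U₀ volume) (hU₁ : LocallyIntegrable U₁ volume) :
    IsWeaklyDivFree U₀ ∧ IsWeaklyDivFree U₁ := by
  have key : ∀ g : EuclideanSpace ℝ (Fin 3) → ℝ, IsTestFunctionOn (⊤ : Opens (EuclideanSpace ℝ (Fin 3))) g →
      (∫ y, ⟪U₀ y, gradient g y⟫) = 0 ∧ (∫ y, ⟪U₁ y, gradient g y⟫) = 0 := by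
    intro g hg
    have h1 := pointwise_div hsol hT₁ hv hθc hU₀ hU₁ hg ht
    have h2 := pointwise_div hsol hT₁ hv hθc hU₀ hU₁ hg ht'
    have hd : (θ t - θ t') * ∫ y, ⟪U₁ y, gradient g y⟫ = 0 := by linear_combination h1 - h2
    have hD1 : (∫ y, ⟪U₁ y, gradient g y⟫) = 0 := (mul_eq_zero.1 hd).resolve_left (sub_ne_zero.2 hne)
    refine ⟨?_, hD1⟩
    rw [hD1, mul_zero, add_zero] at h1
    exact h1
  exact ⟨fun g hg => (key g hg).1, fun g hg => (key g hg).2⟩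

/-- **EVANESCENT NORMALISATION: THE STEADY PART IS A STEADY WEAK EULER FIELD.**  If the modulation solves the root-form Riccati
equation `θ' = θ (β + γθ)` on `(−∞,T₁)` (i.e. `α = 0`: the case `θ → 0` in the far past after subtracting the limit root) and is not
constant there, then `∫⟪U₀, DΦ·U₀⟫ = 0` for every divergence-free test field `Φ` and `U₀` is weakly divergence free: `U₀` is a steady
weak Euler field in `L²_loc`. [folklore] -/
theorem steady_weak_euler_of_riccati_root
    (hsol : IsDistributionalNSSolutionOn (slab (EuclideanSpace ℝ (Fin 3)) (Iio 0) isOpen_Iio) 0 0 v p)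
    (hT₁ : T₁ ≤ 0) (hv : ∀ τ, τ < T₁ → v τ = fun x => U₀ x + θ τ • U₁ x) (hθ1 : ContDiff ℝ 1 θ)
    {β γ : ℝ} (hode : ∀ t, t < T₁ → deriv θ t = θ t * (β + γ * θ t))
    {t t' : ℝ} (ht : t < T₁) (ht' : t' < T₁) (hne : θ t ≠ θ t')
    (hU₀ : LocallyIntegrable U₀ volume) (hU₁ : LocallyIntegrable U₁ volume)
    (hU₀2 : LocallyIntegrable (fun y => ‖U₀ y‖ ^ 2) volume) (hU₁2 : LocallyIntegrable (fun y => ‖U₁ y‖ ^ 2) volume) :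
    (∀ Φ : EuclideanSpace ℝ (Fin 3) → EuclideanSpace ℝ (Fin 3), IsTestFunctionOn (⊤ : Opens (EuclideanSpace ℝ (Fin 3))) Φ →
      (∀ z, VectorCalculus.divergence Φ z = 0) → ∫ y, ⟪U₀ y, (fderiv ℝ Φ y) (U₀ y)⟫ = 0) ∧ IsWeaklyDivFree U₀ := by
  refine ⟨fun Φ hΦ hdiv => ?_, (isWeaklyDivFree_pair_of_nonconstant hsol hT₁ hv hθ1.continuous ht ht' hne hU₀ hU₁).1⟩
  have hode' : ∀ r, r < T₁ → deriv θ r = 0 + β * θ r + γ * θ r ^ 2 := fun r hr => by rw [hode r hr]; ring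
  have h := (riccati_split hsol hT₁ hv hθ1 hode' ht ht' hne hU₀ hU₁ hU₀2 hU₁2 hΦ hdiv).1
  simpa using h

end ModulatedEuler

end Summit.NavierStokesRegularity.NavierStokesRegularity.Theorems.PowerGaugeEulerLiouville

end
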